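import Mathlib.Data.ZMod.Units
import Mathlib.Data.Nat.Totient
import Mathlib.Analysis.Complex.Basic
import Mathlib.Data.Nat.Cast.Order.Field
import HarnessLib

/-!
# Route `PrimeLevelFamEdge`, crux K_B (stmt-Parity-20343), line `diagonal_kernel_split` rev 4, plan Ω,
# node L7b (OMEGA-BLUEPRINT v4 §3c) `OffDiagFlatness`, part 3: **the flatness COUNT — at most `M/h + 1` integers of
# `[1, M]` in one class mod `h`, hence at most `L·(M/h + 1)` pairs `(l, m) ∈ [1,L]×[1,M]` with `t·l·m ≡ c (mod h)`
# for a reduced class `c` (the multiplicity `m(h)` of the L7-bridge `norm_sum_mul_levelLargePart_le_of_multiplicity`)**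

The L7-bridge (`OffDiagLevelLargeSieve.norm_sum_mul_levelLargePart_le_of_multiplicity(_zmod)`, prover-7) consumes the
flatness of the K_B sources as a MULTIPLICITY bound: for every modulus `h` and every class representative `c`, the number
of sources `(l, m, …)` with modulus `h` whose class `−(l/d₁)(m/d₂)((r+1)s)⁻¹ mod h` has representative `c` is `≤ m(h)`,
and then `‖Σ_i w_i·levelLargePart …‖ ≤ (Σ_i m(md i)‖w_i‖²)^{1/2}·(1 + log H)(2(N+1)/R + 4H)^{1/2}‖F‖₂` (fibre
Cauchy–Schwarz `sum_norm_sq_sum_fiber_le` + Parseval + E18). This file is the count behind `m(h) ≍ LM/h + L` (line lead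
DISPATCH 2026-08-28T16:18:46Z «#{(l,m) ∈ [1,M]² : lm ≡ b (mod h)} ≤ … M²/h + M»):

* `card_filter_Icc_natCast_eq_le` — one class of one modulus meets `[1, M]` in at most `M/h + 1` integers (`h ≥ 1`;
  the map `m ↦ (m−1)/h` is injective on a class);
* `card_filter_Icc_unit_mul_eq_le` — the same for the fibres `{m : u·m = a}` of a unit multiplier `u`;
* **`card_filter_prod_mul_eq_le_of_isUnit`** — for a reduced class `c` (`IsUnit c`) and ANY `t`:
  `#{(l,m) ∈ [1,L]×[1,M] : t·l·m = c} ≤ L·(M/h + 1)` (a pair reaches a reduced class only through `t·l` a unit, and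
  then `m` runs through one class); `card_filter_prod_unit_mul_eq_le` — the form with the unit condition on `t·l` in the
  filter and an arbitrary class `a`; `card_filter_val_eq_le_card_filter_eq` — passage to the representative form
  `(…).val = c` used by `…_of_multiplicity_zmod` (for `c ≥ h` the fibre is empty).
Sub-filters (divisibility `d₁ ∣ l`, `d₂ ∣ m`, coprimality, box membership) only lower a count (`Finset.card_le_card`);
after the reparametrisation `l = d₁α`, `m = d₂β` the lemma applies to `(α, β) ∈ [1, M/d₁]×[1, M/d₂]`. Not here: the
non-reduced classes (`#{(l,m) : lm ≡ b} ≤ τ(h)·LM/h + L` via the `gcd(l,h)`-strata) — the L7 machinery only queries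
reduced classes (`IsUnit (a i)` in the bridge). Companion weighted forms: `OffDiagFlatness` /
`OffDiagFlatnessAggregate` (`ℓ²`-flatness under `|c_m| ≤ κ m^{-1/2}`, Minkowski aggregation, `sum_units_sq_bilinear_le`).
Pure finite counting, no definition; helper toward `stub_offDiagBelowSlack_io` (`--supports stmt-Parity-20343`);
closes nothing; standard axioms.
«The programme SEARCHES and TYPES; no claim about Landau–Siegel zeros, Theorems 1–2 of arXiv:2211.02515 or
a repaired Margin232 until a kernel theorem says so.»
-/

namespace Summit.Parity.GeneralizedHardyLittlewood.Theorems.BeyondDiagonalBeatsQuarter.OffDiag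

open Finset

section Count

variable {h : ℕ}

/-- **Gap count**: a set of integers in `[1, M]` any two of whose members differ by at least `k ≥ 1` has at most
`M/k + 1` members (`m ↦ (m − 1)/k` is injective on it and lands in `[0, M/k]`). [folklore] -/
theorem card_le_div_add_one_of_gap {k M : ℕ} (hk : 0 < k) {S : Finset ℕ} (hS : S ⊆ Icc 1 M)
    (hgap : ∀ m ∈ S, ∀ m' ∈ S, m < m' → m + k ≤ m') : S.card ≤ M / k + 1 := by
  calc S.card ≤ (range (M / k + 1)).card := by
        refine Finset.card_le_card_of_injOn (fun m => (m - 1) / k) (fun m hm => ?_) ?_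
        · -- maps into `[0, M/k]`
          have hmM : m ≤ M := (Finset.mem_Icc.1 (hS hm)).2
          simp only [Finset.coe_range, Set.mem_Iio]
          exact Nat.lt_succ_of_le (Nat.div_le_div_right (by omega))
        · -- injective on `S`
          intro m hm m' hm' hmm
          simp only at hmm
          by_contra hne
          rcases Nat.lt_or_gt_of_ne hne with hlt | hgt
          · have hle := hgap m hm m' hm' hlt
            have h1m : 1 ≤ m := (Finset.mem_Icc.1 (hS hm)).1
            have : (m - 1) / k + 1 ≤ (m' - 1) / k := by
              rw [← Nat.add_div_right (m - 1) hk]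
              exact Nat.div_le_div_right (by omega)
            omega
          · have hle := hgap m' hm' m hm hgt
            have h1m : 1 ≤ m' := (Finset.mem_Icc.1 (hS hm')).1
            have : (m' - 1) / k + 1 ≤ (m - 1) / k := by
              rw [← Nat.add_div_right (m' - 1) hk]
              exact Nat.div_le_div_right (by omega)
            omega
    _ = M / k + 1 := Finset.card_range _

/-- **One class of one modulus meets `[1, M]` in at most `M/h + 1` integers** (`h ≥ 1`): two distinct members of a
class differ by a positive multiple of `h`. [folklore] -/
theorem card_filter_Icc_natCast_eq_le (hh : 0 < h) (M : ℕ) (ρ : ZMod h) :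
    ((Icc 1 M).filter (fun m : ℕ => (m : ZMod h) = ρ)).card ≤ M / h + 1 := by
  classical
  refine card_le_div_add_one_of_gap hh (Finset.filter_subset _ _) fun m hm m' hm' hlt => ?_
  have h1 := (Finset.mem_filter.1 hm).2
  have h2 := (Finset.mem_filter.1 hm').2
  have hmod : (m' : ZMod h) = (m : ZMod h) := by rw [h1, h2]
  rw [ZMod.natCast_eq_natCast_iff] at hmod
  obtain ⟨j, hj⟩ := (Nat.modEq_iff_dvd' hlt.le).1 hmod.symm
  rcases Nat.eq_zero_or_pos j with hj0 | hj0
  · exfalso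
    rw [hj0, mul_zero] at hj
    omega
  · have : h ≤ h * j := Nat.le_mul_of_pos_right h hj0
    omega

/-- **A non-reduced multiplier**: for `l ≥ 1`, `h ≥ 1` and any class `b`, two solutions `m < m'` of `l·m ≡ b (mod h)`
differ by a multiple of `h / gcd(l,h)`, so `#{m ∈ [1,M] : l·m = b} ≤ M/(h/gcd(l,h)) + 1` (`= gcd(l,h)·M/h + 1`; the
`gcd`-strata of the line lead's count `#{(l,m) : lm ≡ b} ≲ τ(h)M²/h + M` for NON-reduced `b`, summing
`Σ_{l ≤ L} gcd(l,h) ≤ τ(h)·L`). [folklore] -/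
theorem card_filter_Icc_natCast_mul_eq_le (hh : 0 < h) (l M : ℕ) (b : ZMod h) :
    ((Icc 1 M).filter (fun m : ℕ => ((l : ℕ) : ZMod h) * (m : ZMod h) = b)).card ≤ M / (h / Nat.gcd l h) + 1 := by
  classical
  set g := Nat.gcd l h with hg
  have hg0 : 0 < g := Nat.gcd_pos_of_pos_right l hh
  have hgh : g ∣ h := Nat.gcd_dvd_right l h
  have hgl : g ∣ l := Nat.gcd_dvd_left l h
  have hk : 0 < h / g := Nat.div_pos (Nat.le_of_dvd hh hgh) hg0
  refine card_le_div_add_one_of_gap hk (Finset.filter_subset _ _) fun m hm m' hm' hlt => ?_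
  have h1 := (Finset.mem_filter.1 hm).2
  have h2 := (Finset.mem_filter.1 hm').2
  have hmod : ((l * m' : ℕ) : ZMod h) = ((l * m : ℕ) : ZMod h) := by push_cast; rw [h1, h2]
  rw [ZMod.natCast_eq_natCast_iff] at hmod
  -- `h ∣ l·m' − l·m = l·(m' − m)`, hence `h/g ∣ (l/g)·(m' − m)` and, by coprimality, `h/g ∣ m' − m`
  have hdvd : h ∣ l * (m' - m) := by
    rw [Nat.mul_sub]
    exact (Nat.modEq_iff_dvd' (Nat.mul_le_mul_left l hlt.le)).1 hmod.symm
  have hdvd' : h / g ∣ (l / g) * (m' - m) := by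
    have hl : l = g * (l / g) := (Nat.mul_div_cancel' hgl).symm
    have hh' : h = g * (h / g) := (Nat.mul_div_cancel' hgh).symm
    rw [hh', hl, mul_assoc] at hdvd
    exact Nat.dvd_of_mul_dvd_mul_left hg0 hdvd
  have hcop : Nat.Coprime (h / g) (l / g) := by
    rw [hg, Nat.gcd_comm]
    exact Nat.coprime_div_gcd_div_gcd (by rw [Nat.gcd_comm]; exact hg0)
  obtain ⟨j, hj⟩ := hcop.dvd_of_dvd_mul_left hdvd'
  rcases Nat.eq_zero_or_pos j with hj0 | hj0
  · exfalso
    rw [hj0, mul_zero] at hj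
    omega
  · have : h / g ≤ h / g * j := Nat.le_mul_of_pos_right _ hj0
    omega

/-- **The fibres of a unit multiplier**: for `u` a unit mod `h ≥ 1` and any class `a`,
`#{m ∈ [1,M] : u·m = a} ≤ M/h + 1` (the fibre is the class `u⁻¹a`). [folklore] -/
theorem card_filter_Icc_unit_mul_eq_le (hh : 0 < h) (M : ℕ) {u : ZMod h} (hu : IsUnit u) (a : ZMod h) :
    ((Icc 1 M).filter (fun m : ℕ => u * (m : ZMod h) = a)).card ≤ M / h + 1 := by
  classical
  obtain ⟨u', rfl⟩ := hu
  have hset : (Icc 1 M).filter (fun m : ℕ => (u' : ZMod h) * (m : ZMod h) = a) =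
      (Icc 1 M).filter (fun m : ℕ => (m : ZMod h) = (u'⁻¹ : (ZMod h)ˣ) * a) := by
    refine Finset.filter_congr fun m _ => ?_
    constructor
    · intro hm
      rw [← hm, ← mul_assoc, Units.inv_mul, one_mul]
    · intro hm
      rw [hm, ← mul_assoc, Units.mul_inv, one_mul]
  rw [hset]
  exact card_filter_Icc_natCast_eq_le hh M _

/-- **The bilinear count for a reduced class.** For `h ≥ 1`, any `t` mod `h` and a REDUCED class `c` (`IsUnit c`):
`#{(l, m) ∈ [1,L]×[1,M] : t·l·m = c} ≤ L·(M/h + 1)` — a pair reaches the reduced class only if `t·l` is a unit, and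
then `m` runs through the single class `(t l)⁻¹c`. This is the multiplicity `m(h)` per outer index that the L7-bridge
`norm_sum_mul_levelLargePart_le_of_multiplicity` takes (OMEGA-BLUEPRINT v4 §3c: `≍ M²/h + M` at `L = M`).
[folklore] -/
theorem card_filter_prod_mul_eq_le_of_isUnit (hh : 0 < h) (L M : ℕ) (t : ZMod h) {c : ZMod h} (hc : IsUnit c) :
    ((Icc 1 L ×ˢ Icc 1 M).filter (fun p : ℕ × ℕ => t * (p.1 : ZMod h) * (p.2 : ZMod h) = c)).card ≤
      L * (M / h + 1) := by
  classical
  rw [Finset.card_eq_sum_ones, Finset.sum_filter, Finset.sum_product]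
  calc ∑ l ∈ Icc 1 L, ∑ m ∈ Icc 1 M, (if t * (l : ZMod h) * (m : ZMod h) = c then 1 else 0)
      ≤ ∑ l ∈ Icc 1 L, (M / h + 1) := by
        refine Finset.sum_le_sum fun l _ => ?_
        rw [← Finset.sum_filter, ← Finset.card_eq_sum_ones]
        by_cases htl : IsUnit (t * (l : ZMod h))
        · exact card_filter_Icc_unit_mul_eq_le hh M htl c
        · -- no `m` reaches a reduced class through a non-unit `t·l`
          have hempty : (Icc 1 M).filter (fun m : ℕ => t * (l : ZMod h) * (m : ZMod h) = c) = ∅ := by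
            refine Finset.filter_eq_empty_iff.2 fun m _ hm => htl ?_
            have : IsUnit (t * (l : ZMod h) * (m : ZMod h)) := by rw [hm]; exact hc
            exact isUnit_of_mul_isUnit_left this
          rw [hempty, Finset.card_empty]
          exact Nat.zero_le _
    _ = L * (M / h + 1) := by rw [Finset.sum_const, Nat.card_Icc, smul_eq_mul]; simp

/-- **The bilinear count with the unit condition in the filter** (any class `a`): for `h ≥ 1` and any `t`,
`#{(l, m) ∈ [1,L]×[1,M] : t·l a unit ∧ t·l·m = a} ≤ L·(M/h + 1)`. [folklore] -/
theorem card_filter_prod_unit_mul_eq_le [DecidablePred fun x : ZMod h => IsUnit x] (hh : 0 < h) (L M : ℕ) (t a : ZMod h) :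
    ((Icc 1 L ×ˢ Icc 1 M).filter
        (fun p : ℕ × ℕ => IsUnit (t * (p.1 : ZMod h)) ∧ t * (p.1 : ZMod h) * (p.2 : ZMod h) = a)).card ≤
      L * (M / h + 1) := by
  classical
  rw [Finset.card_eq_sum_ones, Finset.sum_filter, Finset.sum_product]
  calc ∑ l ∈ Icc 1 L, ∑ m ∈ Icc 1 M,
        (if IsUnit (t * (l : ZMod h)) ∧ t * (l : ZMod h) * (m : ZMod h) = a then 1 else 0)
      ≤ ∑ l ∈ Icc 1 L, (M / h + 1) := by
        refine Finset.sum_le_sum fun l _ => ?_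
        rw [← Finset.sum_filter, ← Finset.card_eq_sum_ones]
        by_cases htl : IsUnit (t * (l : ZMod h))
        · calc ((Icc 1 M).filter
              (fun m : ℕ => IsUnit (t * (l : ZMod h)) ∧ t * (l : ZMod h) * (m : ZMod h) = a)).card
              ≤ ((Icc 1 M).filter (fun m : ℕ => t * (l : ZMod h) * (m : ZMod h) = a)).card :=
                Finset.card_le_card (Finset.monotone_filter_right _ fun m _ hm => hm.2)
            _ ≤ M / h + 1 := card_filter_Icc_unit_mul_eq_le hh M htl a
        · have hempty : (Icc 1 M).filter
              (fun m : ℕ => IsUnit (t * (l : ZMod h)) ∧ t * (l : ZMod h) * (m : ZMod h) = a) = ∅ :=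
            Finset.filter_eq_empty_iff.2 fun m _ hm => htl hm.1
          rw [hempty, Finset.card_empty]
          exact Nat.zero_le _
    _ = L * (M / h + 1) := by rw [Finset.sum_const, Nat.card_Icc, smul_eq_mul]; simp

/-- **Passage to class representatives** (the indexing `(a i).val = c` of `…_of_multiplicity_zmod`): for any finite
family with classes `cl i : ZMod h` (`h ≥ 1`) and any `c : ℕ`, `#{i : (cl i).val = c} ≤ #{i : cl i = ↑c}` (equality
for `c < h`, and the left side is `0` for `c ≥ h`). [folklore] -/
theorem card_filter_val_eq_le_card_filter_eq [NeZero h] {ι : Type*} (I : Finset ι) (cl : ι → ZMod h) (c : ℕ) :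
    (I.filter (fun i => (cl i).val = c)).card ≤ (I.filter (fun i => cl i = (c : ZMod h))).card := by
  classical
  refine Finset.card_le_card (Finset.monotone_filter_right _ fun i _ hi => ?_)
  rw [← hi, ZMod.natCast_zmod_val]

/-- **The bilinear count in representative form**: for `h ≥ 1`, any `t`, a finite window `[1,L]×[1,M]` and any
`c : ℕ`, `#{(l, m) : t·l a unit ∧ (t·l·m).val = c} ≤ L·(M/h + 1)`. [folklore] -/
theorem card_filter_prod_unit_mul_val_eq_le [NeZero h] [DecidablePred fun x : ZMod h => IsUnit x] (L M : ℕ) (t : ZMod h) (c : ℕ) :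
    ((Icc 1 L ×ˢ Icc 1 M).filter
        (fun p : ℕ × ℕ => IsUnit (t * (p.1 : ZMod h)) ∧ (t * (p.1 : ZMod h) * (p.2 : ZMod h)).val = c)).card ≤
      L * (M / h + 1) := by
  classical
  have hh : 0 < h := Nat.pos_of_ne_zero (NeZero.ne h)
  calc ((Icc 1 L ×ˢ Icc 1 M).filter
        (fun p : ℕ × ℕ => IsUnit (t * (p.1 : ZMod h)) ∧ (t * (p.1 : ZMod h) * (p.2 : ZMod h)).val = c)).card
      ≤ ((Icc 1 L ×ˢ Icc 1 M).filter
        (fun p : ℕ × ℕ => IsUnit (t * (p.1 : ZMod h)) ∧ t * (p.1 : ZMod h) * (p.2 : ZMod h) = (c : ZMod h))).card := by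
        refine Finset.card_le_card (Finset.monotone_filter_right _ fun p _ hp => ⟨hp.1, ?_⟩)
        rw [← hp.2, ZMod.natCast_zmod_val]
    _ ≤ L * (M / h + 1) := card_filter_prod_unit_mul_eq_le hh L M t _

/-- **Real-valued form for the bridge's hypothesis `hm`**: `(#{…} : ℝ) ≤ L·(M/h + 1)` with REAL division
(`⌊M/h⌋ ≤ M/h`). [folklore] -/
theorem card_filter_prod_mul_eq_le_real (hh : 0 < h) (L M : ℕ) (t : ZMod h) {c : ZMod h} (hc : IsUnit c) :
    (((Icc 1 L ×ˢ Icc 1 M).filter (fun p : ℕ × ℕ => t * (p.1 : ZMod h) * (p.2 : ZMod h) = c)).card : ℝ) ≤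
      (L : ℝ) * ((M : ℝ) / h + 1) := by
  have h1 := card_filter_prod_mul_eq_le_of_isUnit hh L M t hc
  calc (((Icc 1 L ×ˢ Icc 1 M).filter (fun p : ℕ × ℕ => t * (p.1 : ZMod h) * (p.2 : ZMod h) = c)).card : ℝ)
      ≤ ((L * (M / h + 1) : ℕ) : ℝ) := by exact_mod_cast h1
    _ ≤ (L : ℝ) * ((M : ℝ) / h + 1) := by
        push_cast
        exact mul_le_mul_of_nonneg_left (by gcongr; exact Nat.cast_div_le) (Nat.cast_nonneg L)

end Count

/-! ### Rev 2 (append): divisor-reparametrised sources and NON-reduced classes (the `gcd`-strata of S3's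
`sum_levels_switch_eq_levelAPSum_reduced`: class `−(ab/g)(cs/g)⁻¹ mod n/g` ⇔ `ab ≡ g·c″ (mod n)`, a non-reduced class) -/

section CountRev2

variable {h : ℕ}

/-- **Divisor-reparametrised sources.** For `h ≥ 1`, `d₁, d₂ ≥ 1`, any `t` and a reduced class `c`:
`#{(l, m) ∈ [1,M]² : d₁ ∣ l, d₂ ∣ m, t·(l/d₁)·(m/d₂) = c} ≤ (M/d₁)·((M/d₂)/h + 1)` — the map `(l,m) ↦ (l/d₁, m/d₂)` is
injective on these pairs and lands in the fibre of `card_filter_prod_mul_eq_le_of_isUnit` over `[1, M/d₁]×[1, M/d₂]`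
(the shape of the K_B sources: `a = l/d₁`, `b = m/d₂` in `OffDiagBlockStrata.sum_levels_switch_eq_levelAPSum`). [folklore] -/
theorem card_filter_prod_dvd_mul_eq_le_of_isUnit (hh : 0 < h) (M : ℕ) {d₁ d₂ : ℕ} (hd₁ : 0 < d₁) (hd₂ : 0 < d₂)
    (t : ZMod h) {c : ZMod h} (hc : IsUnit c) :
    ((Icc 1 M ×ˢ Icc 1 M).filter (fun p : ℕ × ℕ =>
        d₁ ∣ p.1 ∧ d₂ ∣ p.2 ∧ t * ((p.1 / d₁ : ℕ) : ZMod h) * ((p.2 / d₂ : ℕ) : ZMod h) = c)).card ≤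
      (M / d₁) * (M / d₂ / h + 1) := by
  classical
  refine le_trans ?_ (card_filter_prod_mul_eq_le_of_isUnit hh (M / d₁) (M / d₂) t hc)
  refine Finset.card_le_card_of_injOn (fun p : ℕ × ℕ => (p.1 / d₁, p.2 / d₂)) (fun p hp => ?_) ?_
  · -- maps into the `(α, β)`-fibre
    simp only [Finset.coe_filter, Finset.mem_product, Finset.mem_Icc, Set.mem_setOf_eq] at hp ⊢
    obtain ⟨⟨⟨h1l, hlM⟩, ⟨h1m, hmM⟩⟩, hdl, hdm, hcl⟩ := hp
    refine ⟨⟨⟨?_, Nat.div_le_div_right hlM⟩, ⟨?_, Nat.div_le_div_right hmM⟩⟩, hcl⟩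
    · exact Nat.div_pos (Nat.le_of_dvd h1l hdl) hd₁
    · exact Nat.div_pos (Nat.le_of_dvd h1m hdm) hd₂
  · intro p hp p' hp' hpp
    simp only [Finset.coe_filter, Set.mem_setOf_eq] at hp hp'
    simp only [Prod.mk.injEq] at hpp
    obtain ⟨h1, h2⟩ := hpp
    exact Prod.ext ((Nat.div_left_inj hp.2.1 hp'.2.1).1 h1) ((Nat.div_left_inj hp.2.2.1 hp'.2.2.1).1 h2)

/-- **The bilinear count for a NON-reduced class** (the `gcd`-strata): for `h ≥ 1`, any class `b` and windows
`[1,L]×[1,M]`, `#{(l, m) : l·m = b (mod h)} ≤ Σ_{l ≤ L} (M/(h/gcd(l,h)) + 1)` (`card_filter_Icc_natCast_mul_eq_le` per `l`).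
[folklore] -/
theorem card_filter_prod_natCast_mul_eq_le (hh : 0 < h) (L M : ℕ) (b : ZMod h) :
    ((Icc 1 L ×ˢ Icc 1 M).filter (fun p : ℕ × ℕ => (p.1 : ZMod h) * (p.2 : ZMod h) = b)).card ≤
      ∑ l ∈ Icc 1 L, (M / (h / Nat.gcd l h) + 1) := by
  classical
  rw [Finset.card_eq_sum_ones, Finset.sum_filter, Finset.sum_product]
  refine Finset.sum_le_sum fun l _ => ?_
  rw [← Finset.sum_filter, ← Finset.card_eq_sum_ones]
  exact card_filter_Icc_natCast_mul_eq_le hh l M b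

/-- The multiples of `g ≥ 1` in `[1, A]` number `A / g`. [folklore] -/
theorem card_filter_Icc_dvd_eq (A : ℕ) (g : ℕ) : ((Icc 1 A).filter (fun l : ℕ => g ∣ l)).card = A / g := by
  have hI : Icc 1 A = Ioc 0 A := by
    ext l
    simp only [Finset.mem_Icc, Finset.mem_Ioc]
    omega
  rw [hI]
  exact Nat.Ioc_filter_dvd_card_eq_div A g

/-- **The `gcd`-sum**: `Σ_{l ≤ A} gcd(l, h) ≤ τ(h)·A` for `h ≥ 1` (`gcd(l,h)` is a divisor `g` of `h` dividing `l`, and the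
multiples of `g` in `[1,A]` number `A/g ≤ A/g`; so the sum is `≤ Σ_{g ∣ h} g·(A/g) ≤ τ(h)·A`). [folklore] -/
theorem sum_Icc_gcd_le (hh : 0 < h) (A : ℕ) :
    ∑ l ∈ Icc 1 A, Nat.gcd l h ≤ h.divisors.card * A := by
  classical
  -- `gcd(l,h) = Σ_{g ∈ divisors h} [g = gcd(l,h)]·g`
  have hpt : ∀ l ∈ Icc 1 A, Nat.gcd l h = ∑ g ∈ h.divisors, if g = Nat.gcd l h then g else 0 := by
    intro l _
    rw [Finset.sum_ite_eq' h.divisors (Nat.gcd l h) (fun g => g), if_pos]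
    exact Nat.mem_divisors.2 ⟨Nat.gcd_dvd_right l h, hh.ne'⟩
  rw [Finset.sum_congr rfl hpt, Finset.sum_comm]
  calc ∑ g ∈ h.divisors, ∑ l ∈ Icc 1 A, (if g = Nat.gcd l h then g else 0)
      ≤ ∑ g ∈ h.divisors, ∑ l ∈ Icc 1 A, (if g ∣ l then g else 0) := by
        refine Finset.sum_le_sum fun g _ => Finset.sum_le_sum fun l _ => ?_
        split_ifs with h1 h2 h2
        · exact le_rfl
        · exact absurd (h1 ▸ Nat.gcd_dvd_left l h) h2
        · exact Nat.zero_le _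
        · exact le_rfl
    _ = ∑ g ∈ h.divisors, g * (A / g) := by
        refine Finset.sum_congr rfl fun g _ => ?_
        rw [← Finset.sum_filter, Finset.sum_const, smul_eq_mul, card_filter_Icc_dvd_eq, mul_comm]
    _ ≤ ∑ g ∈ h.divisors, A := Finset.sum_le_sum fun g _ => Nat.mul_div_le A g
    _ = h.divisors.card * A := by rw [Finset.sum_const, smul_eq_mul]

/-- **The bilinear count for a NON-reduced class, closed form** (the line lead's «`≤ τ(h)·M²/h + M`»): for `h ≥ 1`,
any class `b`: `#{(l, m) ∈ [1,L]×[1,M] : l·m = b (mod h)} ≤ τ(h)·L·(M/h) + L` (real division). [folklore] -/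
theorem card_filter_prod_natCast_mul_eq_le_real (hh : 0 < h) (L M : ℕ) (b : ZMod h) :
    (((Icc 1 L ×ˢ Icc 1 M).filter (fun p : ℕ × ℕ => (p.1 : ZMod h) * (p.2 : ZMod h) = b)).card : ℝ) ≤
      (h.divisors.card : ℝ) * L * ((M : ℝ) / h) + L := by
  have hh0 : (0 : ℝ) < h := by exact_mod_cast hh
  have h1 := card_filter_prod_natCast_mul_eq_le hh L M b
  -- each term: `M/(h/g) ≤ g·(M/h)` in `ℝ`
  have hterm : ∀ l ∈ Icc 1 L, ((M / (h / Nat.gcd l h) + 1 : ℕ) : ℝ) ≤ (Nat.gcd l h : ℝ) * ((M : ℝ) / h) + 1 := by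
    intro l _
    set g := Nat.gcd l h with hg
    have hg0 : 0 < g := Nat.gcd_pos_of_pos_right l hh
    have hgh : g ∣ h := Nat.gcd_dvd_right l h
    have hk : 0 < h / g := Nat.div_pos (Nat.le_of_dvd hh hgh) hg0
    have hk0 : (0 : ℝ) < ((h / g : ℕ) : ℝ) := by exact_mod_cast hk
    have hgk : ((g : ℕ) : ℝ) * ((h / g : ℕ) : ℝ) = h := by
      rw [← Nat.cast_mul, Nat.mul_div_cancel' hgh]
    push_cast
    gcongr ?_ + 1
    calc ((M / (h / g) : ℕ) : ℝ) ≤ (M : ℝ) / ((h / g : ℕ) : ℝ) := Nat.cast_div_le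
      _ = (g : ℝ) * ((M : ℝ) / h) := by
          rw [← hgk]
          field_simp
  calc (((Icc 1 L ×ˢ Icc 1 M).filter (fun p : ℕ × ℕ => (p.1 : ZMod h) * (p.2 : ZMod h) = b)).card : ℝ)
      ≤ ((∑ l ∈ Icc 1 L, (M / (h / Nat.gcd l h) + 1) : ℕ) : ℝ) := by exact_mod_cast h1
    _ ≤ ∑ l ∈ Icc 1 L, ((Nat.gcd l h : ℝ) * ((M : ℝ) / h) + 1) := by
        push_cast
        exact Finset.sum_le_sum fun l hl => by
          have := hterm l hl
          push_cast at this
          exact this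
    _ = (∑ l ∈ Icc 1 L, (Nat.gcd l h : ℝ)) * ((M : ℝ) / h) + L := by
        rw [Finset.sum_add_distrib, Finset.sum_const, Nat.card_Icc, nsmul_eq_mul, mul_one, Finset.sum_mul]
        congr 1
    _ ≤ (h.divisors.card : ℝ) * L * ((M : ℝ) / h) + L := by
        have hs : (∑ l ∈ Icc 1 L, (Nat.gcd l h : ℝ)) ≤ (h.divisors.card : ℝ) * L := by
          exact_mod_cast sum_Icc_gcd_le hh L
        have hM : (0 : ℝ) ≤ (M : ℝ) / h := by positivity
        gcongr

end CountRev2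

end Summit.Parity.GeneralizedHardyLittlewood.Theorems.BeyondDiagonalBeatsQuarter.OffDiag
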